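import Summits.Ventures.Crystal3D.Theorems.StickyWulffConstantTextureLiminfTexShadowUnsaturateV5
import HarnessLib

/-!
# TexShadow `stub_textureBuild`, TB-0 LEVEL 1: the ATOMIC-SCALE saturated shadow theorem and the dilation that gives the registered target
# (lane T, crux `TextureLiminfV5`, stmt-Ventures-23912; WAKE brief HOME/crystal3d-full-23912-p1/WAKE-20260829T0345Z-textureBuild-TB0.md, block (f); wulff-p2 g18 as TB-0 fallback)

HONEST FRAMING. Venture `Summits/Ventures/Crystal3D` (cell `crystal3d-full`), route `route-Ventures-StickyWulffConstant`, helper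
`--supports` the law-v5 crux `TextureLiminfV5` (stmt-Ventures-23912), registered line `TexShadow` (v8.3/v8.4), stub `stub_textureBuild :
BarlowResolution → BarlowAdhesionR → BilayerWallV5 → PolytopeCalculus → BarlowFreeCertificate → ShadowTheoremSatV5` [XL].  This file is the
ε/θ-and-scaling bookkeeping of that stub ONLY (census-free, standard axioms): nothing atomistic is proved; rung F-C1 not moved.

WHAT.  `ShadowTheoremSatAt c₀ c₁ GWF CWL` (…TexShadowVocabularyV5) asks, for every saturated near-optimal `N`-cluster, for a `(c₀,c₁)`-texture of
volume `≥ (1 − δ)/√2` and energy `≤ (6N − C(x))/N^{2/3} + θ` — a texture at UNIT scale.  Every sub-lemma of the build (grains, cells, tents, walls)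
lives at ATOMIC scale, where the natural statement is **`ShadowTheoremSatAtomicAt`**: a texture with `(1 − δ)·N ≤ √2·vol` and
`energy ≤ (6N − C(x)) + θ·N^{2/3}`.  Since `IsTexture` is dilation-invariant and `vol ↦ r³·vol`, `energy ↦ r²·energy` (wulff-p2 g3
`isTexture_smul` / `vol_smul` / `energy_smul`, …TextureLiminfUnsaturate), dilating by `r = N^{-1/3}` turns the atomic statement into the registered one:
* `shadowTheoremSatAt_of_atomic : ShadowTheoremSatAtomicAt c₀ c₁ GWF CWL → ShadowTheoremSatAt c₀ c₁ GWF CWL` (any law, any wall siblings);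
* `shadowTheoremSatV5_of_atomic : ShadowTheoremSatAtomicV5 → ShadowTheoremSatV5`;
* `textureBuild_of_atomic` — the registered stub's shape from the atomic one, for ANY five hypotheses (so the skeleton can write
  `stub_textureBuild := textureBuild_of_atomic stub_textureBuildAtomic` with `stub_textureBuildAtomic : BarlowResolution → BarlowAdhesionR →
  BilayerWallV5 → PolytopeCalculus → BarlowFreeCertificate → ShadowTheoremSatAtomicV5`, `BarlowAdhesionR` being skeleton-local).
TB-0's further split of the atomic statement (grains / cover / tiling identity / patch-energy identity) is the memo HOME/wulff-p2/g18/tb0/TB-0.md.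
WHAT THIS IS NOT: no construction of any texture; F-C1 not moved.
-/

noncomputable section

open scoped BigOperators InnerProductSpace ENNReal Pointwise
open MeasureTheory Filter Finset

namespace Summit.Ventures.Crystal3D.Cruxes.TextureLiminf.TexShadow

open Summit.Ventures.Crystal3D

/-! ## The atomic-scale saturated shadow theorem -/

/-- **The saturated shadow theorem at law `(c₀, c₁)`, ATOMIC SCALE** (wall siblings `GWF`, `CWL` as in `ShadowTheoremSatAt`): for every
saturated near-optimal `N`-cluster (`N ≥ N₀(K, δ, θ)`) there is a `(c₀, c₁)`-texture with `(1 − δ)·N ≤ √2·vol` and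
`energy ≤ (6N − numContacts x) + θ·N^{2/3}` — the texture drawn around the atoms themselves (grain solids of diameter `∼ N^{1/3}`). -/
def ShadowTheoremSatAtomicAt (c₀ c₁ : ℝ) (GWF CWL : Prop) : Prop :=
  GWF → CWL →
  Summit.Ventures.Crystal3D.Theses.StickyWulffConstant.NoReconstructionGain →
  Summit.Ventures.Crystal3D.Theses.StickyWulffConstant.StackingLiminf →
  ∀ K δ θ : ℝ, 0 < δ → 0 < θ → ∃ N₀ : ℕ, ∀ N : ℕ, N₀ ≤ N → ∀ x : Fin N → E3, IsUnitPacking x →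
    IsSaturated x →
    6 * (N : ℝ) - (numContacts x : ℝ) ≤ K * (N : ℝ) ^ ((2 : ℝ) / 3) →
    ∃ (n : ℕ) (G : Fin n → Set E3) (A : Fin n → (E3 ≃ₗᵢ[ℝ] E3)) (c : Fin n → Fin n → ℝ)
      (m : Fin n → Fin n → E3), IsTexture c₀ c₁ n G A c m ∧ (1 - δ) * (N : ℝ) ≤ Real.sqrt 2 * vol n G ∧
      energy n G A c m ≤ (6 * (N : ℝ) - (numContacts x : ℝ)) + θ * (N : ℝ) ^ ((2 : ℝ) / 3)

/-- **The saturated shadow theorem at law v5 `(13/25, ½)`, ATOMIC SCALE** — TB-0's level-1 target for `stub_textureBuild`. -/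
def ShadowTheoremSatAtomicV5 : Prop :=
  ShadowTheoremSatAtomicAt (13 / 25) (1 / 2) Summit.Ventures.Crystal3D.Theses.StickyWulffConstant.GenericWallFloorV5
    Summit.Ventures.Crystal3D.Theses.StickyWulffConstant.CoaxialWallLaw

/-! ## Dilation by `N^{-1/3}` -/

/-- `(N^{-1/3})³ = N⁻¹` and `(N^{-1/3})² = (N^{2/3})⁻¹` for `N > 0`. -/
theorem rpow_neg_third_pow (N : ℝ) (hN : 0 < N) :
    (N ^ (-(1 : ℝ) / 3)) ^ 3 = N⁻¹ ∧ (N ^ (-(1 : ℝ) / 3)) ^ 2 = (N ^ ((2 : ℝ) / 3))⁻¹ := by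
  constructor
  · rw [← Real.rpow_natCast, ← Real.rpow_mul hN.le]
    norm_num
    exact Real.rpow_neg_one N
  · rw [← Real.rpow_natCast, ← Real.rpow_mul hN.le, ← Real.rpow_neg hN.le]
    norm_num

/-- **Atomic ⇒ unit scale, any law**: dilate the atomic-scale texture by `r = N^{-1/3}` (`IsTexture` invariant, `vol ↦ vol/N`,
`energy ↦ energy/N^{2/3}`). -/
theorem shadowTheoremSatAt_of_atomic {c₀ c₁ : ℝ} {GWF CWL : Prop} (h : ShadowTheoremSatAtomicAt c₀ c₁ GWF CWL) :
    ShadowTheoremSatAt c₀ c₁ GWF CWL := by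
  intro hG hC hNRG hSL K δ θ hδ hθ
  obtain ⟨N₀, hN₀⟩ := h hG hC hNRG hSL K δ θ hδ hθ
  refine ⟨max N₀ 1, fun N hN x hx hsat hK => ?_⟩
  have hN₀N : N₀ ≤ N := le_trans (le_max_left _ _) hN
  have hN1 : (1 : ℝ) ≤ (N : ℝ) := by exact_mod_cast le_trans (le_max_right _ _) hN
  have hNpos : (0 : ℝ) < (N : ℝ) := by linarith
  obtain ⟨n, G, A, c, m, hT, hvol, hEn⟩ := hN₀ N hN₀N x hx hsat hK
  set r : ℝ := (N : ℝ) ^ (-(1 : ℝ) / 3) with hr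
  have hrpos : 0 < r := Real.rpow_pos_of_pos hNpos _
  obtain ⟨hr3, hr2⟩ := rpow_neg_third_pow (N : ℝ) hNpos
  have hN23pos : (0 : ℝ) < (N : ℝ) ^ ((2 : ℝ) / 3) := Real.rpow_pos_of_pos hNpos _
  refine ⟨n, fun f => r • G f, A, c, m, isTexture_smul hT hrpos, ?_, ?_⟩
  · -- volume: `√2 · r³ · vol = √2 · vol / N ≥ 1 − δ`
    rw [vol_smul n G hrpos.le, hr3]
    have : (1 - δ) ≤ Real.sqrt 2 * vol n G / (N : ℝ) := by
      rw [le_div_iff₀ hNpos]; linarith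
    simpa [div_eq_mul_inv, mul_comm, mul_left_comm, mul_assoc] using this
  · -- energy: `r² · energy = energy / N^{2/3} ≤ (6N − C)/N^{2/3} + θ`
    rw [energy_smul n G A c m hrpos, hr2]
    have hdiv : energy n G A c m / (N : ℝ) ^ ((2 : ℝ) / 3) ≤
        (6 * (N : ℝ) - (numContacts x : ℝ)) / (N : ℝ) ^ ((2 : ℝ) / 3) + θ := by
      rw [div_le_iff₀ hN23pos, add_mul, div_mul_cancel₀ _ hN23pos.ne']
      linarith
    simpa [div_eq_mul_inv, mul_comm] using hdiv

/-- **Atomic ⇒ unit scale at law v5.** -/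
theorem shadowTheoremSatV5_of_atomic (h : ShadowTheoremSatAtomicV5) : ShadowTheoremSatV5 :=
  shadowTheoremSatAt_of_atomic h

/-- **The registered stub's shape from the atomic one**, for ANY five hypotheses `P₁ … P₅` (in the skeleton: `BarlowResolution`, `BarlowAdhesionR`,
`BilayerWallV5`, `PolytopeCalculus`, `BarlowFreeCertificate`): `(P₁ → … → P₅ → ShadowTheoremSatAtomicV5) → (P₁ → … → P₅ → ShadowTheoremSatV5)`. -/
theorem textureBuild_of_atomic {P₁ P₂ P₃ P₄ P₅ : Prop} (h : P₁ → P₂ → P₃ → P₄ → P₅ → ShadowTheoremSatAtomicV5) :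
    P₁ → P₂ → P₃ → P₄ → P₅ → ShadowTheoremSatV5 :=
  fun h₁ h₂ h₃ h₄ h₅ => shadowTheoremSatV5_of_atomic (h h₁ h₂ h₃ h₄ h₅)

end Summit.Ventures.Crystal3D.Cruxes.TextureLiminf.TexShadow

end
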